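import Literature.MathematicalPhysics.QuantumLattice.WilsonLoops
import Summits.Ventures.YMGap.Thresholds.SharpLargeN

/-!
# Venture YMGap — Theorem C, consequence VI: large-`N` concentration of every Wilson loop (indeed of
# every lattice path word) for `|β| < 1/(8d)` — Shen–Zhu–Zhu Cor. 1.5 at the sharp window

HONEST FRAMING: venture file (cell `pub-ymgap`, track (a), item A2, large-`N` leg = Theorem A (A4)).
KERNEL-CHECKED: for a finite list of lattice steps (edge, orientation) — e.g. the darts of a closed
walk, whose holonomy trace is the Wilson loop (`matrixCylinder_pathFun_walk`) — the normalised
trace `(1/N) Re tr Π_k U_{e_k}^{±1}` is a smooth cylinder function of the links it uses, with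
per-link Frobenius-Lipschitz constant `≤ n/√N` (`n` = number of steps; telescoping over the word,
unitary invariance of the Hilbert–Schmidt norm). CONDITIONAL (named printed fact
`shenZhuZhu_bakryEmery_transfer`, through `sharp_functionalInequalities`): `path_variance_sharp` —
for `d ≥ 2`, `N ≥ 1`, `|β| < 1/(8d)`, every infinite-volume limit point `μ` at tree coupling `Nβ`,
every finite edge set `Λ` and every word of `n` steps:
`Var_μ((1/N) Re tr Π) ≤ (1/K) · |Λ| n²/N`, `K = N/2 - 4dN|β|` — so every fixed Wilson loop
concentrates as `N → ∞` ('t Hooft scaling) below `1/(8d)` (SZZ Cor. 1.5 prints `4n(n-3)/(K_S N)` below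
`1/(16(d-1))`; constants here are not optimised). No factorisation statement for products of loops
is derived; nothing at physical couplings.

Reference: H. Shen, R. Zhu, X. Zhu, CMP 400 (2023), Cor. 1.5, §4.2.
-/

noncomputable section

namespace Summit.Ventures.YMGap.HessianSharp

open MeasureTheory ProbabilityTheory Matrix
open Literature.MathematicalPhysics.QuantumFieldTheory
open Literature.MathematicalPhysics.QuantumLattice
open scoped Matrix Matrix.Norms.Frobenius ContDiff

variable {d N : ℕ}

/-! ## Words in the link matrices -/

/-- Extension of a family of link matrices over `Λ` by the identity outside `Λ`. -/
def extendOne (Λ : Finset (Literature.MathematicalPhysics.QuantumLattice.ZdEdge d)) (M : ↥Λ → Matrix (Fin N) (Fin N) ℂ) (e : Literature.MathematicalPhysics.QuantumLattice.ZdEdge d) :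
    Matrix (Fin N) (Fin N) ℂ :=
  if h : e ∈ Λ then M ⟨e, h⟩ else 1

/-- The matrix of one step `(e, forward?)`: `M_e` or `M_eᴴ`. -/
def stepMat (Λ : Finset (Literature.MathematicalPhysics.QuantumLattice.ZdEdge d)) (M : ↥Λ → Matrix (Fin N) (Fin N) ℂ) (s : Literature.MathematicalPhysics.QuantumLattice.ZdEdge d × Bool) :
    Matrix (Fin N) (Fin N) ℂ :=
  if s.2 then extendOne Λ M s.1 else (extendOne Λ M s.1)ᴴ

/-- The ordered product of the step matrices of a word. -/
def wordProd (Λ : Finset (Literature.MathematicalPhysics.QuantumLattice.ZdEdge d)) (steps : List (Literature.MathematicalPhysics.QuantumLattice.ZdEdge d × Bool))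
    (M : ↥Λ → Matrix (Fin N) (Fin N) ℂ) : Matrix (Fin N) (Fin N) ℂ :=
  (steps.map (stepMat Λ M)).prod

/-- The normalised trace of a word in the link matrices: `(1/N) Re tr Π_k M_{e_k}^{(ᴴ)}`. -/
def pathFun (Λ : Finset (Literature.MathematicalPhysics.QuantumLattice.ZdEdge d)) (steps : List (Literature.MathematicalPhysics.QuantumLattice.ZdEdge d × Bool))
    (M : ↥Λ → Matrix (Fin N) (Fin N) ℂ) : ℝ :=
  (N : ℝ)⁻¹ * (wordProd Λ steps M).trace.re

/-- The empty word has product `1`. -/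
@[simp] theorem wordProd_nil (Λ : Finset (Literature.MathematicalPhysics.QuantumLattice.ZdEdge d)) (M : ↥Λ → Matrix (Fin N) (Fin N) ℂ) :
    wordProd Λ [] M = 1 := by simp [wordProd]

/-- Product of a word with a first step prepended. -/
@[simp] theorem wordProd_cons (Λ : Finset (Literature.MathematicalPhysics.QuantumLattice.ZdEdge d)) (s : Literature.MathematicalPhysics.QuantumLattice.ZdEdge d × Bool) (steps : List (Literature.MathematicalPhysics.QuantumLattice.ZdEdge d × Bool))
    (M : ↥Λ → Matrix (Fin N) (Fin N) ℂ) :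
    wordProd Λ (s :: steps) M = stepMat Λ M s * wordProd Λ steps M := by simp [wordProd]

/-! ## Smoothness -/

/-- Each extended link matrix is a smooth function of the family (a coordinate or a constant). -/
theorem contDiff_extendOne (Λ : Finset (Literature.MathematicalPhysics.QuantumLattice.ZdEdge d)) (e : Literature.MathematicalPhysics.QuantumLattice.ZdEdge d) :
    ContDiff ℝ ∞ (fun M : ↥Λ → Matrix (Fin N) (Fin N) ℂ => extendOne Λ M e) := by
  unfold extendOne
  split_ifs with h
  · exact contDiff_apply ℝ (Matrix (Fin N) (Fin N) ℂ) (⟨e, h⟩ : ↥Λ)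
  · exact contDiff_const

/-- Each step matrix is smooth. -/
theorem contDiff_stepMat (Λ : Finset (Literature.MathematicalPhysics.QuantumLattice.ZdEdge d)) (s : Literature.MathematicalPhysics.QuantumLattice.ZdEdge d × Bool) :
    ContDiff ℝ ∞ (fun M : ↥Λ → Matrix (Fin N) (Fin N) ℂ => stepMat Λ M s) := by
  unfold stepMat
  split_ifs
  · exact contDiff_extendOne Λ s.1
  · exact (conjTransposeCLM (N := N)).contDiff.comp (contDiff_extendOne Λ s.1)

/-- The word product is smooth. -/
theorem contDiff_wordProd (Λ : Finset (Literature.MathematicalPhysics.QuantumLattice.ZdEdge d)) (steps : List (Literature.MathematicalPhysics.QuantumLattice.ZdEdge d × Bool)) :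
    ContDiff ℝ ∞ (fun M : ↥Λ → Matrix (Fin N) (Fin N) ℂ => wordProd Λ steps M) := by
  induction steps with
  | nil =>
      simp only [wordProd_nil]
      exact contDiff_const
  | cons s steps ih =>
      have : (fun M : ↥Λ → Matrix (Fin N) (Fin N) ℂ => wordProd Λ (s :: steps) M) =
          fun M => stepMat Λ M s * wordProd Λ steps M := by
        funext M; exact wordProd_cons Λ s steps M
      rw [this]
      exact (contDiff_stepMat Λ s).mul ih

/-- The normalised word trace is smooth. -/
theorem contDiff_pathFun (Λ : Finset (Literature.MathematicalPhysics.QuantumLattice.ZdEdge d)) (steps : List (Literature.MathematicalPhysics.QuantumLattice.ZdEdge d × Bool)) :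
    ContDiff ℝ ∞ (pathFun (N := N) Λ steps) :=
  contDiff_const.mul ((reTraceCLM (N := N)).contDiff.comp (contDiff_wordProd Λ steps))

/-! ## Unitarity of the factors -/

/-- For `SU(N)` links the extended matrices are unitary. -/
theorem extendOne_mem_unitary (Λ : Finset (Literature.MathematicalPhysics.QuantumLattice.ZdEdge d)) (M : ↥Λ → Matrix.specialUnitaryGroup (Fin N) ℂ)
    (e : Literature.MathematicalPhysics.QuantumLattice.ZdEdge d) :
    extendOne Λ (fun e' => (M e' : Matrix (Fin N) (Fin N) ℂ)) e ∈ Matrix.unitaryGroup (Fin N) ℂ := by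
  unfold extendOne
  split_ifs with h
  · exact su_mem_unitaryGroup _
  · exact Submonoid.one_mem _

/-- For `SU(N)` links the step matrices are unitary. -/
theorem stepMat_mem_unitary (Λ : Finset (Literature.MathematicalPhysics.QuantumLattice.ZdEdge d)) (M : ↥Λ → Matrix.specialUnitaryGroup (Fin N) ℂ)
    (s : Literature.MathematicalPhysics.QuantumLattice.ZdEdge d × Bool) :
    stepMat Λ (fun e' => (M e' : Matrix (Fin N) (Fin N) ℂ)) s ∈ Matrix.unitaryGroup (Fin N) ℂ := by
  unfold stepMat
  split_ifs
  · exact extendOne_mem_unitary Λ M s.1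
  · exact conjTranspose_mem_unitaryGroup (extendOne_mem_unitary Λ M s.1)

/-- For `SU(N)` links the word product is unitary. -/
theorem wordProd_mem_unitary (Λ : Finset (Literature.MathematicalPhysics.QuantumLattice.ZdEdge d)) (M : ↥Λ → Matrix.specialUnitaryGroup (Fin N) ℂ)
    (steps : List (Literature.MathematicalPhysics.QuantumLattice.ZdEdge d × Bool)) :
    wordProd Λ steps (fun e' => (M e' : Matrix (Fin N) (Fin N) ℂ)) ∈ Matrix.unitaryGroup (Fin N) ℂ := by
  induction steps with
  | nil =>
      rw [wordProd_nil]
      exact Submonoid.one_mem _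
  | cons s steps ih =>
      rw [wordProd_cons]
      exact Submonoid.mul_mem _ (stepMat_mem_unitary Λ M s) ih

/-! ## Telescoping: the word is Lipschitz in each link -/

/-- **Telescoping bound**: the word products of two `SU(N)` link families differ, in Frobenius
norm, by at most the sum over the steps of the link differences (`‖U X‖_F = ‖X‖_F = ‖X U‖_F`
for unitary `U`, `‖Xᴴ‖_F = ‖X‖_F`). -/
theorem frobNorm_wordProd_sub_le (Λ : Finset (Literature.MathematicalPhysics.QuantumLattice.ZdEdge d)) (M M' : ↥Λ → Matrix.specialUnitaryGroup (Fin N) ℂ)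
    (steps : List (Literature.MathematicalPhysics.QuantumLattice.ZdEdge d × Bool)) :
    frobNorm (wordProd Λ steps (fun e' => (M e' : Matrix (Fin N) (Fin N) ℂ)) -
        wordProd Λ steps (fun e' => (M' e' : Matrix (Fin N) (Fin N) ℂ))) ≤
      (steps.map fun s => frobNorm (extendOne Λ (fun e' => (M e' : Matrix (Fin N) (Fin N) ℂ)) s.1 -
        extendOne Λ (fun e' => (M' e' : Matrix (Fin N) (Fin N) ℂ)) s.1)).sum := by
  induction steps with
  | nil => simp [frobNorm_zero]
  | cons s steps ih =>
      rw [wordProd_cons, wordProd_cons, List.map_cons, List.sum_cons]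
      set A := stepMat Λ (fun e' => (M e' : Matrix (Fin N) (Fin N) ℂ)) s
      set B := stepMat Λ (fun e' => (M' e' : Matrix (Fin N) (Fin N) ℂ)) s
      set P := wordProd Λ steps (fun e' => (M e' : Matrix (Fin N) (Fin N) ℂ))
      set Q := wordProd Λ steps (fun e' => (M' e' : Matrix (Fin N) (Fin N) ℂ))
      have hP : P ∈ Matrix.unitaryGroup (Fin N) ℂ := wordProd_mem_unitary Λ M steps
      have hB : B ∈ Matrix.unitaryGroup (Fin N) ℂ := stepMat_mem_unitary Λ M' s
      have hsplit : A * P - B * Q = (A - B) * P + B * (P - Q) := by noncomm_ring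
      have hstep : frobNorm (A - B) = frobNorm
          (extendOne Λ (fun e' => (M e' : Matrix (Fin N) (Fin N) ℂ)) s.1 -
            extendOne Λ (fun e' => (M' e' : Matrix (Fin N) (Fin N) ℂ)) s.1) := by
        simp only [A, B, stepMat]
        split_ifs
        · rfl
        · rw [← conjTranspose_sub, frobNorm_conjTranspose]
      calc frobNorm (A * P - B * Q) = frobNorm ((A - B) * P + B * (P - Q)) := by rw [hsplit]
        _ ≤ frobNorm ((A - B) * P) + frobNorm (B * (P - Q)) := frobNorm_add_le _ _
        _ = frobNorm (A - B) + frobNorm (P - Q) := by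
            rw [frobNorm_mul_unitary _ hP, frobNorm_unitary_mul hB]
        _ ≤ _ := by rw [hstep]; exact add_le_add le_rfl ih

/-- If two link families agree off `e₀`, every extended link difference is at most the distance at `e₀`. -/
theorem frobNorm_extendOne_sub_le (Λ : Finset (Literature.MathematicalPhysics.QuantumLattice.ZdEdge d)) (e₀ : ↥Λ)
    (M M' : ↥Λ → Matrix.specialUnitaryGroup (Fin N) ℂ) (h : ∀ e', e' ≠ e₀ → M e' = M' e') (e : Literature.MathematicalPhysics.QuantumLattice.ZdEdge d) :
    frobNorm (extendOne Λ (fun e' => (M e' : Matrix (Fin N) (Fin N) ℂ)) e -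
        extendOne Λ (fun e' => (M' e' : Matrix (Fin N) (Fin N) ℂ)) e) ≤ suFrobDist (M e₀) (M' e₀) := by
  unfold extendOne
  split_ifs with he
  · dsimp only
    by_cases hee : (⟨e, he⟩ : ↥Λ) = e₀
    · rw [hee]; exact le_rfl
    · rw [h _ hee, sub_self, frobNorm_zero]
      exact suFrobDist_nonneg _ _
  · rw [sub_self, frobNorm_zero]
    exact suFrobDist_nonneg _ _

/-- **Per-link Lipschitz constant `n/√N`** of the normalised word trace (`n` = number of steps). -/
theorem pathFun_lipschitz (Λ : Finset (Literature.MathematicalPhysics.QuantumLattice.ZdEdge d)) (steps : List (Literature.MathematicalPhysics.QuantumLattice.ZdEdge d × Bool)) (hN : 1 ≤ N)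
    (e₀ : ↥Λ) (M M' : ↥Λ → Matrix.specialUnitaryGroup (Fin N) ℂ)
    (h : ∀ e', e' ≠ e₀ → M e' = M' e') :
    |pathFun Λ steps (fun e' => (M e' : Matrix (Fin N) (Fin N) ℂ)) -
        pathFun Λ steps (fun e' => (M' e' : Matrix (Fin N) (Fin N) ℂ))| ≤
      steps.length * (Real.sqrt N)⁻¹ * suFrobDist (M e₀) (M' e₀) := by
  have hN0 : (0 : ℝ) < N := by exact_mod_cast hN
  have hsq : (0 : ℝ) < Real.sqrt N := Real.sqrt_pos.2 hN0
  set P := wordProd Λ steps (fun e' => (M e' : Matrix (Fin N) (Fin N) ℂ))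
  set Q := wordProd Λ steps (fun e' => (M' e' : Matrix (Fin N) (Fin N) ℂ))
  -- the trace of the difference
  have h1 : (1 : Matrix (Fin N) (Fin N) ℂ) ∈ Matrix.unitaryGroup (Fin N) ℂ := Submonoid.one_mem _
  have htr : |((P - Q) * 1).trace.re| ≤ frobNorm (P - Q) * Real.sqrt N := by
    refine (abs_re_trace_mul_le _ _).trans (le_of_eq ?_)
    rw [← Real.sqrt_sq (frobNorm_nonneg (1 : Matrix (Fin N) (Fin N) ℂ)),
      frobNorm_sq_of_mem_unitaryGroup h1, Fintype.card_fin]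
  rw [Matrix.mul_one] at htr
  -- the telescoping sum, each term bounded by the distance at `e₀`
  have hsum : (steps.map fun s => frobNorm
      (extendOne Λ (fun e' => (M e' : Matrix (Fin N) (Fin N) ℂ)) s.1 -
        extendOne Λ (fun e' => (M' e' : Matrix (Fin N) (Fin N) ℂ)) s.1)).sum ≤
      steps.length * suFrobDist (M e₀) (M' e₀) := by
    have := List.sum_le_card_nsmul (steps.map fun s => frobNorm
      (extendOne Λ (fun e' => (M e' : Matrix (Fin N) (Fin N) ℂ)) s.1 -
        extendOne Λ (fun e' => (M' e' : Matrix (Fin N) (Fin N) ℂ)) s.1)) (suFrobDist (M e₀) (M' e₀))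
      (fun x hx => by
        obtain ⟨s, _, rfl⟩ := List.mem_map.1 hx
        exact frobNorm_extendOne_sub_le Λ e₀ M M' h s.1)
    simpa [nsmul_eq_mul] using this
  have hPQ : frobNorm (P - Q) ≤ steps.length * suFrobDist (M e₀) (M' e₀) :=
    (frobNorm_wordProd_sub_le Λ M M' steps).trans hsum
  -- assemble
  have hdiff : pathFun Λ steps (fun e' => (M e' : Matrix (Fin N) (Fin N) ℂ)) -
      pathFun Λ steps (fun e' => (M' e' : Matrix (Fin N) (Fin N) ℂ)) = (N : ℝ)⁻¹ * (P - Q).trace.re := by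
    simp only [pathFun, P, Q, trace_sub, Complex.sub_re]
    ring
  rw [hdiff, abs_mul, abs_of_pos (inv_pos.2 hN0)]
  have hNsq : (N : ℝ)⁻¹ * Real.sqrt N = (Real.sqrt N)⁻¹ := by
    nth_rw 1 [← Real.mul_self_sqrt hN0.le]
    rw [mul_inv, mul_assoc, inv_mul_cancel₀ hsq.ne', mul_one]
  calc (N : ℝ)⁻¹ * |(P - Q).trace.re| ≤ (N : ℝ)⁻¹ * (frobNorm (P - Q) * Real.sqrt N) :=
        mul_le_mul_of_nonneg_left htr (inv_nonneg.2 hN0.le)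
    _ ≤ (N : ℝ)⁻¹ * (steps.length * suFrobDist (M e₀) (M' e₀) * Real.sqrt N) :=
        mul_le_mul_of_nonneg_left (mul_le_mul_of_nonneg_right hPQ (Real.sqrt_nonneg _))
          (inv_nonneg.2 hN0.le)
    _ = steps.length * (Real.sqrt N)⁻¹ * suFrobDist (M e₀) (M' e₀) := by
        rw [← hNsq]; ring

/-! ## The variance bound at the sharp window -/

/-- **Large-`N` concentration of every word / Wilson loop for `|β| < 1/(8d)`** (SZZ Cor. 1.5 at the
sharp window), conditional on the Bakry–Émery transfer fact: for `d ≥ 2`, `N ≥ 1`, `|β| < 1/(8d)`,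
every infinite-volume limit point `μ` at tree coupling `Nβ`, every finite edge set `Λ` and every word
of `n` steps, `Var_μ((1/N) Re tr Π_k U_{e_k}^{±1}) ≤ (1/K) · |Λ| · n²/N`, `K = N/2 - 4dN|β|`. -/
theorem path_variance_sharp (h : shenZhuZhu_bakryEmery_transfer d N) (hd : 2 ≤ d) (hN : 1 ≤ N)
    {β : ℝ} (hβ : |β| < sharpThresholdSU d)
    {μ : Measure (LGConfig d (Matrix.specialUnitaryGroup (Fin N) ℂ))}
    (hμ : μ ∈ infiniteVolumeLimitPoints (d := d) (fundamentalRep (Fin N)) ((N : ℝ) * β))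
    (Λ : Finset (Literature.MathematicalPhysics.QuantumLattice.ZdEdge d)) (steps : List (Literature.MathematicalPhysics.QuantumLattice.ZdEdge d × Bool)) :
    Var[matrixCylinder Λ (pathFun Λ steps); μ] ≤
      1 / sharpBakryEmeryConstSU N d β * (Λ.card * (steps.length : ℝ) ^ 2 / N) := by
  have hFI := sharp_functionalInequalities h hd hN hβ μ hμ Λ (pathFun Λ steps)
    (fun _ => steps.length * (Real.sqrt N)⁻¹) (contDiff_pathFun Λ steps)
    (fun _ => by positivity) (fun e M M' hMM' => pathFun_lipschitz Λ steps hN e M M' hMM')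
  refine hFI.2.trans (le_of_eq ?_)
  congr 1
  have hN0 : (0 : ℝ) < N := by exact_mod_cast hN
  rw [Finset.sum_const, Finset.card_univ, Fintype.card_coe, nsmul_eq_mul, mul_pow, inv_pow,
    Real.sq_sqrt hN0.le]
  field_simp

/-! ## Dictionary: Wilson loops -/

/-- For a walk `w` in `ℤ^d` whose links lie in `Λ`, the cylinder function `pathFun Λ (darts of w)` on an
`SU(N)` configuration is the normalised Wilson loop / path trace `(1/N) Re tr ρ(hol_w(U))`
(`walkHolonomy` of `WilsonLoops`; group inverses become conjugate transposes). -/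
theorem matrixCylinder_pathFun_walk {x y : Literature.Probability.LatticeModels.Site d}
    (w : (Literature.Probability.LatticeModels.zdGraph d).Walk x y) (Λ : Finset (Literature.MathematicalPhysics.QuantumLattice.ZdEdge d))
    (hΛ : ∀ e ∈ w.darts, (dartStep e).1 ∈ Λ) (U : LGConfig d (Matrix.specialUnitaryGroup (Fin N) ℂ)) :
    matrixCylinder Λ (pathFun Λ (w.darts.map dartStep)) U =
      (N : ℝ)⁻¹ * ((walkHolonomy U w : Matrix.specialUnitaryGroup (Fin N) ℂ) :
        Matrix (Fin N) (Fin N) ℂ).trace.re := by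
  simp only [matrixCylinder, pathFun]
  congr 3
  -- the word product equals the coerced holonomy, factor by factor
  unfold wordProd walkHolonomy
  rw [List.map_map, Submonoid.coe_list_prod, List.map_map]
  refine congrArg List.prod (List.map_congr_left fun e he => ?_)
  have hmem := hΛ e he
  simp only [Function.comp_apply, stepMat, dartHolonomy, extendOne, dif_pos hmem]
  split_ifs
  · rfl
  · exact (su_coe_inv _).symm

end Summit.Ventures.YMGap.HessianSharp
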